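import Summits.QuantumFields.YangMills.Theorems.BalabanUVNodesN09CentralWindowForwardLaw
import Summits.QuantumFields.YangMills.Theorems.BalabanUVNodesN07CentralResponseOnto
import HarnessLib

/-!
# BalabanUVNodes ∕ N09 — NON-DEGENERACY OF THE CHART READ OF THE (0.4) FIBRE MAP AT EVERY POINT OF THE CENTRAL `α`-WINDOW (FILE 10 = INTENT-6d, part 1)

Cell `pub-ymgap` (YM-PLAN Track A), width seat `pub-ymgap-dag-n09-w4` g5; count-neutral helper of K1⁹ = stmt-QuantumFields-27364 (`--supports`, `--as helper`).  [I] = [Balaban1987RG1].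
The `hjac0` input of dag-n09-w6's `exists_perBondCharts_of_forwardLaws`: the density of the forward law of `…N09CentralWindowForwardLaw` does not vanish on the window.  Non-degeneracy
at a window point is n07-w2's onto central response ([Balaban1985Averaging] Prop. 3); it is moved to every point of the ONE chart at `b = V_{i₀}` by the transition cocycle of the
exponential chart ([Helgason2000] Ch. I Thm 1.14 (12)).

WHAT IS PROVED (0 def, 0 sorry).  §1 `contDiffAt_avgM_apply_of_small` (per-bond smoothness of Node00's `avgM` from the guard AT `c` alone), `coeField_update`, `hasDerivAt_testCurve`, `coe_testCurve`.
§2 ★★ `coe_sliceDeriv_apply` — at a window point `W₁`, `↑(D_XΦ((V(U),↑W₁),0)·Z) = ↑E(W₁)⋆ · D(W ↦ avgM W c)(↑U₁)[δ_{β(c)}·(↑g₁·(↑q·Z·↑q⋆))]` (`U₁ = U[β(c) ↦ g₁]`, `g₁ = pre⁻¹W₁post⁻¹`, `q = post`;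
two derivatives along the ray `t ↦ tZ`, `D log(1) = id`, n07-e's per-bond `contDiffAt_corrM`) · ★★★ `sliceDeriv_surjective` (n07-w2's `centralResponse_onto_sharp` at `U₁`, `Ad_{post}` conjugation) ·
★★★ `det_sliceDeriv_ne_zero` (`det D_XΦ((V(U),↑W₁),0) ≠ 0` at every window point, `α ≤ 1∕24`, `α < δ_N`, `157·α < L^{−(d−1)}`).

HONEST FRAMING.  Count-neutral; classical Lie-group chart calculus ∕ change of variables BY NAME on the tree's typed (0.4) objects; nothing of Bałaban's estimates asserted;
`hreg` NOT discharged; N09 NOT discharged; conjunct 1 (Lemma 4) ∕ FLAG №7 untouched; K0⁷ ∕ K1⁹ ∕ K3⁸ NOT closed; counts unmoved; one finite four-torus programme at fixed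
`ε = L^{−K}` — R4 closes the conditional rung `BalabanLadder.UV` only; NOT ℝ⁴ ∕ infinite volume ∕ OS; the Yang–Mills mass gap (Clay) is NOT proved by any of this.
-/

noncomputable section

open scoped Matrix.Norms.L2Operator Topology ContDiff ENNReal
open Filter Set Function MeasureTheory NormedSpace

namespace Summit.QuantumFields.YangMills.BalabanUVNodes.N09CentralWindowNondegenerate

open Literature.MathematicalPhysics.QuantumFieldTheory.Balaban1983to89
open Literature.MathematicalPhysics.QuantumFieldTheory.Balaban1983to89.HaarExponentialChart
open Literature.MathematicalPhysics.QuantumFieldTheory.Balaban1983to89.HaarExponentialChart.IsChartRep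
open Literature.MathematicalPhysics.QuantumFieldTheory.Balaban1983to89.BlockAveraging (Small Idx avgFun loopHol instNonemptyIdx)
open Literature.MathematicalPhysics.QuantumFieldTheory.Balaban1983to89.BlockAveragingHaarAC (centralBond pre post openHol IsCentral)
open Literature.MathematicalPhysics.QuantumFieldTheory.Balaban1983to89.BlockAveragingEMLHaarAC (fibreFamily fibreMap FibreSmall fibreGuard
  fibreFamily_of_isCentral coe_fibreFamily_of_not_isCentral dist1_fibreFamily_of_not_isCentral fibreMap_of_mem avgFun_update_centralBond_self
  small_update_centralBond_self_iff loopHol_update_centralBond_self isOpen_fibreGuard)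
open Literature.MathematicalPhysics.QuantumFieldTheory.Balaban1983to89.ExpMeanLog (eml expMeanLogSU deltaSU)
open Literature.MathematicalPhysics.QuantumFieldTheory.Balaban1983to89.MatrixLog (mlog)
open Literature.MathematicalPhysics.QuantumFieldTheory.Balaban1983to89.Node00
open Literature.MathematicalPhysics.QuantumLattice (fundamentalRep fundamentalRep_apply)
open Summit.QuantumFields.YangMills.BalabanUVNodes.N09ChartReadAveragingSmooth (coe_fderiv_apply_eq hasDerivAt_along_ray)
open Summit.QuantumFields.YangMills.BalabanUVNodes.N09ChartReadAveragingSubmersion (conj_mem_lie)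
open Summit.QuantumFields.YangMills.BalabanUVNodes.N09ForwardLawTools
open Summit.QuantumFields.YangMills.BalabanUVNodes.N09CentralWindowChart

variable {P : Params} {j : ℕ} {N : ℕ} [NeZero N]

/-! ## §1  Calculus helpers: the (0.4) matrix model is `C^∞` per bond on the guard; the one-bond test curve -/

section Helpers

/-- **Per-bond smoothness of the matrix extension of (0.4)**: `W ↦ avgM W c` is `C^∞` at `↑U₁` as soon as `U₁` is inside the guard AT `c` (no condition at other bonds).
[cite: Balaban1987RG1, (0.4) p.253] -/
theorem contDiffAt_avgM_apply_of_small (U₁ : GaugeField P j (SU N)) (c : PBond P (j + 1)) (h : Small (expMeanLogSU (n := Fin N)) U₁ c) :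
    ContDiffAt ℝ ⊤ (fun W : PBond P j → Matrix (Fin N) (Fin N) ℂ => avgM W c) (coeField U₁) :=
  (contDiffAt_corrM c (norm_loopM_coeField_sub_one_lt_one U₁ c h)).mul (contDiff_axialM c).contDiffAt

omit [NeZero N] in
/-- `coeField` of a one-bond update is the update of `coeField`. [cite: Balaban1987RG1, (0.4) p.253 (bookkeeping)] -/
theorem coeField_update (U : GaugeField P j (SU N)) (β : PBond P j) (g : SU N) :
    coeField (update U β g) = update (coeField U) β (g : Matrix (Fin N) (Fin N) ℂ) := by
  funext b
  by_cases hb : b = β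
  · subst hb; simp only [coeField, update_self]
  · simp only [coeField, update_of_ne hb]

omit [NeZero N] in
/-- The one-bond test curve `t ↦ ↑g₁ · (↑q · e^{tZ} · ↑q⋆)` has velocity `↑g₁ · (↑q · Z · ↑q⋆)` at `t = 0`. [cite: Balaban1987RG1, (0.4) p.253 (bookkeeping)] -/
theorem hasDerivAt_testCurve (g₁ q : SU N) (Z : Matrix (Fin N) (Fin N) ℂ) :
    HasDerivAt (fun t : ℝ => (g₁ : Matrix (Fin N) (Fin N) ℂ) * ((q : Matrix (Fin N) (Fin N) ℂ) * exp (t • Z) * star (q : Matrix (Fin N) (Fin N) ℂ)))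
      ((g₁ : Matrix (Fin N) (Fin N) ℂ) * ((q : Matrix (Fin N) (Fin N) ℂ) * Z * star (q : Matrix (Fin N) (Fin N) ℂ))) 0 := by
  have h1 : HasDerivAt (fun t : ℝ => exp (t • Z)) Z 0 := by
    have := hasDerivAt_exp_smul_const (𝕂 := ℝ) Z (0 : ℝ)
    rwa [zero_smul, exp_zero, one_mul] at this
  exact ((h1.const_mul (q : Matrix (Fin N) (Fin N) ℂ)).mul_const (star (q : Matrix (Fin N) (Fin N) ℂ))).const_mul _

/-- The coe of the test curve in `SU(N)`: `↑(g₁·(q·Θ(tZ)·q⁻¹)) = ↑g₁·(↑q·e^{tZ}·↑q⋆)`. [cite: Helgason2000, Ch. I §1 Thm. 1.14 (13) p. 96 (bookkeeping)] -/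
theorem coe_testCurve (g₁ q : SU N) (Z : (specialUnitaryLogChart (Fin N)).lie) (t : ℝ) :
    ((g₁ * (q * (isChartRep_specialUnitaryGroup (n := Fin N)).expChart (t • Z) * q⁻¹) : SU N) : Matrix (Fin N) (Fin N) ℂ) =
      (g₁ : Matrix (Fin N) (Fin N) ℂ) * ((q : Matrix (Fin N) (Fin N) ℂ) * exp (t • ((Z : (specialUnitaryLogChart (Fin N)).lie) : Matrix (Fin N) (Fin N) ℂ)) *
        star (q : Matrix (Fin N) (Fin N) ℂ)) := by
  rw [Submonoid.coe_mul, Submonoid.coe_mul, Submonoid.coe_mul, coe_inv_SU, coe_expChart_SU, Submodule.coe_smul]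

end Helpers

/-! ## §2  Non-degeneracy AT A WINDOW POINT: the slice of `Φ` at base `W₁ ∈ S` has onto (hence invertible) derivative at `0` (n07-w2's central response) -/

section Base

/-- ★★ **THE DERIVATIVE OF THE SLICE AT A WINDOW POINT, ALONG A RAY, IN MATRICES.**  For `W₁` in the central `α`-window (`α < δ_N`), `Z ∈ 𝔰𝔲(N)`, with `g₁ = pre⁻¹·W₁·post⁻¹`,
`U₁ = U[β(c) ↦ g₁]`, `e₁ = E(W₁)`:  `↑(D_X Φ((V(U),↑W₁),0)·Z) = ↑e₁⋆ · D(W ↦ avgM W c)(↑U₁)[δ_{β(c)}·(↑g₁·(↑q·Z·↑q⋆))]` (`q = post`).  Along `t ↦ tZ` the slice reads, near `t = 0`,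
`log(↑e₁⋆ · avgM(↑U₁ + δ_β·(↑g₁·↑q·(e^{tZ} − 1)·↑q⋆))(c))`; differentiate with `D log(1) = id`. [cite: Balaban1987RG1, (0.4) p.253 and (2.10) p.267; Balaban1985Averaging, Prop. 3 (124) p.36] -/
theorem coe_sliceDeriv_apply (hj : j + 1 ≤ P.m + P.K) (U : GaugeField P j (SU N)) (c : PBond P (j + 1)) {α : ℝ} (hαδ : α < deltaSU (Fin N))
    (EE : (Idx P → Matrix (Fin N) (Fin N) ℂ) → Matrix (Fin N) (Fin N) ℂ → Matrix (Fin N) (Fin N) ℂ)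
    (hEE : ∀ V A, EE V A = eml (fun i : Idx P => if IsCentral c i then (1 : Matrix (Fin N) (Fin N) ℂ) else V i * star A) * A)
    (Φ : ((Idx P → Matrix (Fin N) (Fin N) ℂ) × Matrix (Fin N) (Fin N) ℂ) × (specialUnitaryLogChart (Fin N)).lie → (specialUnitaryLogChart (Fin N)).lie)
    (hΦ : ∀ p, Φ p = HaarExpChartLocal.proj (specialUnitaryLogChart (Fin N))
      (mlog (star (EE p.1.1 p.1.2) * EE p.1.1 (p.1.2 * exp ((p.2 : (specialUnitaryLogChart (Fin N)).lie) : Matrix (Fin N) (Fin N) ℂ)))))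
    {W₁ : SU N} (hW₁ : ∀ i : Idx P, dist1 (fibreFamily U c W₁ i) ≤ α) (Z : (specialUnitaryLogChart (Fin N)).lie) :
    HasFDerivAt (fun X : (specialUnitaryLogChart (Fin N)).lie => Φ ((fun i => ((openHol U c i : SU N) : Matrix (Fin N) (Fin N) ℂ), (W₁ : Matrix (Fin N) (Fin N) ℂ)), X))
      ((fderiv ℝ Φ ((fun i => ((openHol U c i : SU N) : Matrix (Fin N) (Fin N) ℂ), (W₁ : Matrix (Fin N) (Fin N) ℂ)), 0)).comp
        (ContinuousLinearMap.inr ℝ ((Idx P → Matrix (Fin N) (Fin N) ℂ) × Matrix (Fin N) (Fin N) ℂ) (specialUnitaryLogChart (Fin N)).lie)) 0 ∧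
    ((((fderiv ℝ Φ ((fun i => ((openHol U c i : SU N) : Matrix (Fin N) (Fin N) ℂ), (W₁ : Matrix (Fin N) (Fin N) ℂ)), 0)).comp
        (ContinuousLinearMap.inr ℝ ((Idx P → Matrix (Fin N) (Fin N) ℂ) × Matrix (Fin N) (Fin N) ℂ) (specialUnitaryLogChart (Fin N)).lie)) Z :
          (specialUnitaryLogChart (Fin N)).lie) : Matrix (Fin N) (Fin N) ℂ) =
      star ((fibreMap (expMeanLogSU (n := Fin N)) U c W₁ : SU N) : Matrix (Fin N) (Fin N) ℂ) *
        fderiv ℝ (fun W : PBond P j → Matrix (Fin N) (Fin N) ℂ => avgM W c) (coeField (update U (centralBond c) ((pre U c)⁻¹ * W₁ * (post U c)⁻¹)))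
          (Pi.single (centralBond c) ((((pre U c)⁻¹ * W₁ * (post U c)⁻¹ : SU N) : Matrix (Fin N) (Fin N) ℂ) *
            (((post U c : SU N) : Matrix (Fin N) (Fin N) ℂ) * ((Z : (specialUnitaryLogChart (Fin N)).lie) : Matrix (Fin N) (Fin N) ℂ) *
              star ((post U c : SU N) : Matrix (Fin N) (Fin N) ℂ)))) := by
  -- abbreviations
  obtain ⟨h, hh⟩ : ∃ h', h' = isChartRep_specialUnitaryGroup (n := Fin N) := ⟨_, rfl⟩
  obtain ⟨E, hE⟩ : ∃ E', E' = fibreMap (expMeanLogSU (n := Fin N)) U c := ⟨_, rfl⟩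
  obtain ⟨p, hp⟩ : ∃ p', p' = pre U c := ⟨_, rfl⟩
  obtain ⟨q, hq⟩ : ∃ q', q' = post U c := ⟨_, rfl⟩
  obtain ⟨g₁, hg₁⟩ : ∃ g', g' = p⁻¹ * W₁ * q⁻¹ := ⟨_, rfl⟩
  obtain ⟨par, hpar⟩ : ∃ par' : (Idx P → Matrix (Fin N) (Fin N) ℂ) × Matrix (Fin N) (Fin N) ℂ,
      par' = ((fun i => ((openHol U c i : SU N) : Matrix (Fin N) (Fin N) ℂ)), (W₁ : Matrix (Fin N) (Fin N) ℂ)) := ⟨_, rfl⟩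
  have hpgq : ∀ g : SU N, W₁ * g = p * (g₁ * (q * g * q⁻¹)) * q := fun g => by rw [hg₁]; group
  have hW₁eq : p * g₁ * q = W₁ := by rw [hg₁]; group
  have hW₁s : FibreSmall (expMeanLogSU (n := Fin N)) U c W₁ := fibreSmall_of_mem_window U c hαδ hW₁
  -- the SU-level curve `g(t) = g₁ (q Θ(tZ) q⁻¹)` and its configuration `U_t = U[β ↦ g(t)]`
  have hsmall_t : ∀ {t : ℝ}, FibreSmall (expMeanLogSU (n := Fin N)) U c (W₁ * h.expChart (t • Z)) →
      Small (expMeanLogSU (n := Fin N)) (update U (centralBond c) (g₁ * (q * h.expChart (t • Z) * q⁻¹))) c := by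
    intro t ht
    rw [small_update_centralBond_self_iff hj, ← hp, ← hq, ← hpgq]; exact ht
  have hsmall₀ : Small (expMeanLogSU (n := Fin N)) (update U (centralBond c) g₁) c := by
    have := @hsmall_t 0; simp only [zero_smul, IsChartRep.expChart_zero, mul_one, mul_inv_cancel] at this; exact this hW₁s
  -- joint smoothness of `Φ` at `(par, 0)` and the derivative of the slice at `0`
  have hΦd : ContDiffAt ℝ ⊤ Φ (par, 0) := by
    rw [hpar]
    have h1 : ∀ i, ¬ IsCentral c i → ‖((openHol U c i : SU N) : Matrix (Fin N) (Fin N) ℂ) * star (W₁ : Matrix (Fin N) (Fin N) ℂ) - 1‖ < 1 := by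
      intro i hi; rw [norm_coe_mul_star_sub_one]
      exact (norm_openHol_sub_le_of_mem U c hW₁ hi).trans_lt (hαδ.trans_le ((min_le_left _ _).trans (by norm_num)))
    refine contDiffAt_modelChart c EE hEE Φ hΦ h1 ?_ ?_
    · intro i hi; rw [ZeroMemClass.coe_zero, exp_zero, mul_one]; exact h1 i hi
    · have h0s : FibreSmall (expMeanLogSU (n := Fin N)) U c (W₁ * (isChartRep_specialUnitaryGroup (n := Fin N)).expChart 0) := by
        rw [IsChartRep.expChart_zero, mul_one]; exact hW₁s
      rw [star_modelE_mul_modelE_eq_coe U c EE hEE hW₁s h0s, IsChartRep.expChart_zero, mul_one, inv_mul_cancel, OneMemClass.coe_one, sub_self, norm_zero]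
      exact one_pos
  have hσD : HasFDerivAt (fun X : (specialUnitaryLogChart (Fin N)).lie => Φ (par, X))
      ((fderiv ℝ Φ (par, 0)).comp (ContinuousLinearMap.inr ℝ ((Idx P → Matrix (Fin N) (Fin N) ℂ) × Matrix (Fin N) (Fin N) ℂ) (specialUnitaryLogChart (Fin N)).lie)) 0 :=
    ((hΦd.differentiableAt (by simp)).hasFDerivAt).comp (0 : (specialUnitaryLogChart (Fin N)).lie) (hasFDerivAt_prodMk_right par 0)
  refine ⟨by rw [hpar] at hσD; exact hσD, ?_⟩
  -- (C) the coe of the slice along the ray `t ↦ tZ`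
  have hf₁ : HasDerivAt (fun t : ℝ => ((Φ (par, t • Z) : (specialUnitaryLogChart (Fin N)).lie) : Matrix (Fin N) (Fin N) ℂ))
      ((((fderiv ℝ Φ (par, 0)).comp (ContinuousLinearMap.inr ℝ ((Idx P → Matrix (Fin N) (Fin N) ℂ) × Matrix (Fin N) (Fin N) ℂ)
        (specialUnitaryLogChart (Fin N)).lie)) Z : (specialUnitaryLogChart (Fin N)).lie) : Matrix (Fin N) (Fin N) ℂ) 0 := by
    have hc := ((specialUnitaryLogChart (Fin N)).lie.subtypeL.hasFDerivAt.comp (0 : (specialUnitaryLogChart (Fin N)).lie) hσD)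
    have hr : HasDerivAt (fun t : ℝ => t • Z) Z 0 := ((hasDerivAt_id' (0 : ℝ)).smul_const Z).congr_deriv (one_smul ℝ Z)
    have := hc.comp_hasDerivAt_of_eq (0 : ℝ) hr (by rw [zero_smul])
    exact this
  -- (B) the model along the ray: `t ↦ log(↑e₁⋆ · avgM(V t)(c))`
  set dir : Matrix (Fin N) (Fin N) ℂ := (g₁ : Matrix (Fin N) (Fin N) ℂ) *
    (((q : SU N) : Matrix (Fin N) (Fin N) ℂ) * ((Z : (specialUnitaryLogChart (Fin N)).lie) : Matrix (Fin N) (Fin N) ℂ) * star ((q : SU N) : Matrix (Fin N) (Fin N) ℂ)) with hdir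
  have hV : HasDerivAt (fun t : ℝ => update (coeField U) (centralBond c)
      ((g₁ : Matrix (Fin N) (Fin N) ℂ) * (((q : SU N) : Matrix (Fin N) (Fin N) ℂ) * exp (t • ((Z : (specialUnitaryLogChart (Fin N)).lie) : Matrix (Fin N) (Fin N) ℂ)) *
        star ((q : SU N) : Matrix (Fin N) (Fin N) ℂ))))
      (Pi.single (centralBond c) dir) 0 := by
    refine hasDerivAt_pi.2 fun b => ?_
    by_cases hb : b = centralBond c
    · subst hb; simp only [update_self, Pi.single_eq_same]; exact hasDerivAt_testCurve g₁ q _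
    · simp only [update_of_ne hb, Pi.single_eq_of_ne hb]; exact hasDerivAt_const _ _
  have hV0 : update (coeField U) (centralBond c)
      ((g₁ : Matrix (Fin N) (Fin N) ℂ) * (((q : SU N) : Matrix (Fin N) (Fin N) ℂ) * exp ((0 : ℝ) • ((Z : (specialUnitaryLogChart (Fin N)).lie) : Matrix (Fin N) (Fin N) ℂ)) *
        star ((q : SU N) : Matrix (Fin N) (Fin N) ℂ))) = coeField (update U (centralBond c) g₁) := by
    rw [zero_smul, exp_zero, mul_one, coe_mul_star_coe_SU, mul_one, coeField_update]
  have hA : DifferentiableAt ℝ (fun W : PBond P j → Matrix (Fin N) (Fin N) ℂ => avgM W c) (coeField (update U (centralBond c) g₁)) :=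
    (contDiffAt_avgM_apply_of_small _ c hsmall₀).differentiableAt (by simp)
  have h1 := hA.hasFDerivAt.comp_hasDerivAt_of_eq (0 : ℝ) hV hV0.symm
  have h2 := h1.const_mul (star ((E W₁ : SU N) : Matrix (Fin N) (Fin N) ℂ))
  have hval : star ((E W₁ : SU N) : Matrix (Fin N) (Fin N) ℂ) * avgM (update (coeField U) (centralBond c)
      ((g₁ : Matrix (Fin N) (Fin N) ℂ) * (((q : SU N) : Matrix (Fin N) (Fin N) ℂ) * exp ((0 : ℝ) • ((Z : (specialUnitaryLogChart (Fin N)).lie) : Matrix (Fin N) (Fin N) ℂ)) *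
        star ((q : SU N) : Matrix (Fin N) (Fin N) ℂ)))) c = 1 := by
    rw [hV0, ← coe_avgFun_of_small _ c hsmall₀, avgFun_update_centralBond_self hj, ← hp, ← hq, hW₁eq, hE, star_coe_mul_coe_SU]
  have hlog : HasFDerivAt (mlog : Matrix (Fin N) (Fin N) ℂ → Matrix (Fin N) (Fin N) ℂ)
      ((1 : Matrix (Fin N) (Fin N) ℂ →L[ℂ] Matrix (Fin N) (Fin N) ℂ).restrictScalars ℝ) 1 :=
    (B7TransferAnalyticMean.hasFDerivAt_mlog_one (𝔄 := Matrix (Fin N) (Fin N) ℂ)).restrictScalars ℝ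
  have hf₂ := hlog.comp_hasDerivAt_of_eq (0 : ℝ) h2 hval.symm
  -- (D) the two functions agree near `t = 0`
  have hcurve : Continuous fun t : ℝ => W₁ * h.expChart (t • Z) := by
    rw [hh]
    exact continuous_const.mul ((isChartRep_specialUnitaryGroup (n := Fin N)).continuous_expChart.comp (continuous_id.smul continuous_const))
  have hev₁ : ∀ᶠ t : ℝ in 𝓝 0, FibreSmall (expMeanLogSU (n := Fin N)) U c (W₁ * h.expChart (t • Z)) := by
    have hopen := isOpen_fibreGuard (n := Fin N) U c
    have h0 : W₁ * h.expChart ((0 : ℝ) • Z) ∈ fibreGuard (expMeanLogSU (n := Fin N)) U c := by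
      rw [zero_smul, hh, IsChartRep.expChart_zero, mul_one]; exact hW₁s
    exact hcurve.continuousAt.preimage_mem_nhds (hopen.mem_nhds h0)
  -- the model product along the curve is continuous at `0` with value `1`
  have h1W : ∀ i, ¬ IsCentral c i → ‖((openHol U c i : SU N) : Matrix (Fin N) (Fin N) ℂ) *
      star ((W₁ : Matrix (Fin N) (Fin N) ℂ) * exp ((0 : ℝ) • ((Z : (specialUnitaryLogChart (Fin N)).lie) : Matrix (Fin N) (Fin N) ℂ))) - 1‖ < 1 := by
    intro i hi; rw [zero_smul, exp_zero, mul_one, norm_coe_mul_star_sub_one]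
    exact (norm_openHol_sub_le_of_mem U c hW₁ hi).trans_lt (hαδ.trans_le ((min_le_left _ _).trans (by norm_num)))
  have hModel : ContinuousAt (fun t : ℝ => star (EE (fun i => ((openHol U c i : SU N) : Matrix (Fin N) (Fin N) ℂ)) (W₁ : Matrix (Fin N) (Fin N) ℂ)) *
      EE (fun i => ((openHol U c i : SU N) : Matrix (Fin N) (Fin N) ℂ)) ((W₁ : Matrix (Fin N) (Fin N) ℂ) * exp (t • ((Z : (specialUnitaryLogChart (Fin N)).lie) : Matrix (Fin N) (Fin N) ℂ)))) 0 := by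
    have hEc : ContinuousAt (fun q' : (Idx P → Matrix (Fin N) (Fin N) ℂ) × Matrix (Fin N) (Fin N) ℂ => EE q'.1 q'.2)
        ((fun i => ((openHol U c i : SU N) : Matrix (Fin N) (Fin N) ℂ)),
          (W₁ : Matrix (Fin N) (Fin N) ℂ) * exp ((0 : ℝ) • ((Z : (specialUnitaryLogChart (Fin N)).lie) : Matrix (Fin N) (Fin N) ℂ))) :=
      (contDiffAt_modelE c EE hEE h1W).continuousAt
    have hin : Continuous fun t : ℝ => ((fun i => ((openHol U c i : SU N) : Matrix (Fin N) (Fin N) ℂ)),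
        (W₁ : Matrix (Fin N) (Fin N) ℂ) * exp (t • ((Z : (specialUnitaryLogChart (Fin N)).lie) : Matrix (Fin N) (Fin N) ℂ))) :=
      continuous_const.prodMk (continuous_const.mul ((Literature.Analysis.Calculus.contDiff_exp (𝔸 := Matrix (Fin N) (Fin N) ℂ) (m := ⊤)).continuous.comp
        (continuous_id.smul continuous_const)))
    exact continuousAt_const.mul (ContinuousAt.comp (g := fun q' : (Idx P → Matrix (Fin N) (Fin N) ℂ) × Matrix (Fin N) (Fin N) ℂ => EE q'.1 q'.2)
      (f := fun t : ℝ => ((fun i => ((openHol U c i : SU N) : Matrix (Fin N) (Fin N) ℂ)),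
        (W₁ : Matrix (Fin N) (Fin N) ℂ) * exp (t • ((Z : (specialUnitaryLogChart (Fin N)).lie) : Matrix (Fin N) (Fin N) ℂ)))) (x := (0 : ℝ)) hEc hin.continuousAt)
  have hcoeW : ∀ t : ℝ, (W₁ : Matrix (Fin N) (Fin N) ℂ) * exp (t • ((Z : (specialUnitaryLogChart (Fin N)).lie) : Matrix (Fin N) (Fin N) ℂ)) =
      ((W₁ * (isChartRep_specialUnitaryGroup (n := Fin N)).expChart (t • Z) : SU N) : Matrix (Fin N) (Fin N) ℂ) := by
    intro t; rw [Submonoid.coe_mul, coe_expChart_SU, Submodule.coe_smul]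
  have hkey0 : star (EE (fun i => ((openHol U c i : SU N) : Matrix (Fin N) (Fin N) ℂ)) (W₁ : Matrix (Fin N) (Fin N) ℂ)) *
      EE (fun i => ((openHol U c i : SU N) : Matrix (Fin N) (Fin N) ℂ)) (W₁ : Matrix (Fin N) (Fin N) ℂ) = 1 := by
    have h0s : FibreSmall (expMeanLogSU (n := Fin N)) U c (W₁ * (isChartRep_specialUnitaryGroup (n := Fin N)).expChart 0) := by
      rw [IsChartRep.expChart_zero, mul_one]; exact hW₁s
    have key := star_modelE_mul_modelE_eq_coe U c EE hEE hW₁s h0s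
    rwa [ZeroMemClass.coe_zero, exp_zero, mul_one, IsChartRep.expChart_zero, mul_one, inv_mul_cancel, OneMemClass.coe_one] at key
  have hev₂ : ∀ᶠ t : ℝ in 𝓝 0, ‖star (EE (fun i => ((openHol U c i : SU N) : Matrix (Fin N) (Fin N) ℂ)) (W₁ : Matrix (Fin N) (Fin N) ℂ)) *
      EE (fun i => ((openHol U c i : SU N) : Matrix (Fin N) (Fin N) ℂ)) ((W₁ : Matrix (Fin N) (Fin N) ℂ) * exp (t • ((Z : (specialUnitaryLogChart (Fin N)).lie) : Matrix (Fin N) (Fin N) ℂ))) - 1‖ <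
      innerRadius (specialUnitaryLogChart (Fin N)) := by
    have hopen : IsOpen {M : Matrix (Fin N) (Fin N) ℂ | ‖M - 1‖ < innerRadius (specialUnitaryLogChart (Fin N))} :=
      isOpen_lt (continuous_id.sub continuous_const).norm continuous_const
    refine hModel.preimage_mem_nhds (hopen.mem_nhds ?_)
    show ‖star (EE (fun i => ((openHol U c i : SU N) : Matrix (Fin N) (Fin N) ℂ)) (W₁ : Matrix (Fin N) (Fin N) ℂ)) *
      EE (fun i => ((openHol U c i : SU N) : Matrix (Fin N) (Fin N) ℂ)) ((W₁ : Matrix (Fin N) (Fin N) ℂ) * exp ((0 : ℝ) • ((Z : (specialUnitaryLogChart (Fin N)).lie) : Matrix (Fin N) (Fin N) ℂ))) - 1‖ < _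
    rw [zero_smul, exp_zero, mul_one, hkey0, sub_self, norm_zero]
    exact innerRadius_pos
  -- the two functions agree near `t = 0`
  have hEq : (fun t : ℝ => ((Φ (par, t • Z) : (specialUnitaryLogChart (Fin N)).lie) : Matrix (Fin N) (Fin N) ℂ)) =ᶠ[𝓝 0]
      fun t : ℝ => mlog (star ((E W₁ : SU N) : Matrix (Fin N) (Fin N) ℂ) * avgM (update (coeField U) (centralBond c)
        ((g₁ : Matrix (Fin N) (Fin N) ℂ) * (((q : SU N) : Matrix (Fin N) (Fin N) ℂ) * exp (t • ((Z : (specialUnitaryLogChart (Fin N)).lie) : Matrix (Fin N) (Fin N) ℂ)) *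
          star ((q : SU N) : Matrix (Fin N) (Fin N) ℂ)))) c) := by
    filter_upwards [hev₁, hev₂] with t ht1 ht2
    have ht1' : FibreSmall (expMeanLogSU (n := Fin N)) U c (W₁ * (isChartRep_specialUnitaryGroup (n := Fin N)).expChart (t • Z)) := by
      rw [← hh]; exact ht1
    have hk : ‖(((fibreMap (expMeanLogSU (n := Fin N)) U c W₁)⁻¹ *
        fibreMap (expMeanLogSU (n := Fin N)) U c (W₁ * (isChartRep_specialUnitaryGroup (n := Fin N)).expChart (t • Z)) : SU N) : Matrix (Fin N) (Fin N) ℂ) - 1‖ <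
        innerRadius (specialUnitaryLogChart (Fin N)) := by
      rw [← star_modelE_mul_modelE_eq_coe U c EE hEE hW₁s ht1', Submodule.coe_smul]; exact ht2
    have hk' : ‖fundamentalRep (Fin N) ((fibreMap (expMeanLogSU (n := Fin N)) U c W₁)⁻¹ *
        fibreMap (expMeanLogSU (n := Fin N)) U c (W₁ * (isChartRep_specialUnitaryGroup (n := Fin N)).expChart (t • Z))) - 1‖ <
        innerRadius (specialUnitaryLogChart (Fin N)) := by rw [fundamentalRep_apply]; exact hk
    have hfm : ((fibreMap (expMeanLogSU (n := Fin N)) U c (W₁ * (isChartRep_specialUnitaryGroup (n := Fin N)).expChart (t • Z)) : SU N) : Matrix (Fin N) (Fin N) ℂ) =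
        avgM (update (coeField U) (centralBond c) ((g₁ : Matrix (Fin N) (Fin N) ℂ) * (((q : SU N) : Matrix (Fin N) (Fin N) ℂ) *
          exp (t • ((Z : (specialUnitaryLogChart (Fin N)).lie) : Matrix (Fin N) (Fin N) ℂ)) * star ((q : SU N) : Matrix (Fin N) (Fin N) ℂ)))) c := by
      have hW : W₁ * (isChartRep_specialUnitaryGroup (n := Fin N)).expChart (t • Z) =
          pre U c * (g₁ * (q * (isChartRep_specialUnitaryGroup (n := Fin N)).expChart (t • Z) * q⁻¹)) * post U c := by rw [hpgq, hp, hq]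
      have hs : Small (expMeanLogSU (n := Fin N)) (update U (centralBond c) (g₁ * (q * (isChartRep_specialUnitaryGroup (n := Fin N)).expChart (t • Z) * q⁻¹))) c := by
        have := hsmall_t ht1; rwa [hh] at this
      rw [hW, ← avgFun_update_centralBond_self hj, coe_avgFun_of_small _ c hs, coeField_update, coe_testCurve]
    rw [hpar]
    show ((Φ (((fun i => ((openHol U c i : SU N) : Matrix (Fin N) (Fin N) ℂ)), (W₁ : Matrix (Fin N) (Fin N) ℂ)), t • Z) : (specialUnitaryLogChart (Fin N)).lie) :
      Matrix (Fin N) (Fin N) ℂ) = _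
    rw [modelChart_apply_eq_logChart U c EE hEE Φ hΦ hW₁s ht1' hk, (isChartRep_specialUnitaryGroup (n := Fin N)).coe_logChart hk', fundamentalRep_apply,
      Submonoid.coe_mul, coe_inv_SU, hfm, hE]
  -- uniqueness of the derivative along the ray
  have hderiv := hf₁.unique (hf₂.congr_of_eventuallyEq hEq)
  subst hg₁ hp hq hE hpar
  exact hderiv

/-- ★★★ **NON-DEGENERACY AT EVERY WINDOW POINT**: under the loop `α`-guard hypotheses of n07-w2 (`α ≤ 1∕24`, `α < δ_N`, `157·α < L^{−(d−1)}`) the derivative at `0` of the slice of `Φ` at base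
`W₁ ∈ S` is ONTO `𝔰𝔲(N)` — `…N07CentralResponseOnto.centralResponse_onto_sharp` at the configuration `U[β(c) ↦ pre⁻¹·W₁·post⁻¹]`, read through `coe_sliceDeriv_apply` and the
`Ad`-conjugations `Z = Ad_{post⁻¹} Y`. [cite: Balaban1985Averaging, Prop. 3 (124) p.36; Balaban1987RG1, (0.4), (0.8) p.253] -/
theorem sliceDeriv_surjective (hj : j + 1 ≤ P.m + P.K) (U : GaugeField P j (SU N)) (c : PBond P (j + 1)) {α : ℝ}
    (hα24 : α ≤ 1 / 24) (hαδ : α < deltaSU (Fin N)) (hαL : 157 * α < ((P.L : ℝ) ^ (P.d - 1))⁻¹)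
    (EE : (Idx P → Matrix (Fin N) (Fin N) ℂ) → Matrix (Fin N) (Fin N) ℂ → Matrix (Fin N) (Fin N) ℂ)
    (hEE : ∀ V A, EE V A = eml (fun i : Idx P => if IsCentral c i then (1 : Matrix (Fin N) (Fin N) ℂ) else V i * star A) * A)
    (Φ : ((Idx P → Matrix (Fin N) (Fin N) ℂ) × Matrix (Fin N) (Fin N) ℂ) × (specialUnitaryLogChart (Fin N)).lie → (specialUnitaryLogChart (Fin N)).lie)
    (hΦ : ∀ p, Φ p = HaarExpChartLocal.proj (specialUnitaryLogChart (Fin N))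
      (mlog (star (EE p.1.1 p.1.2) * EE p.1.1 (p.1.2 * exp ((p.2 : (specialUnitaryLogChart (Fin N)).lie) : Matrix (Fin N) (Fin N) ℂ)))))
    {W₁ : SU N} (hW₁ : ∀ i : Idx P, dist1 (fibreFamily U c W₁ i) ≤ α) :
    Function.Surjective ((fderiv ℝ Φ ((fun i => ((openHol U c i : SU N) : Matrix (Fin N) (Fin N) ℂ), (W₁ : Matrix (Fin N) (Fin N) ℂ)), 0)).comp
      (ContinuousLinearMap.inr ℝ ((Idx P → Matrix (Fin N) (Fin N) ℂ) × Matrix (Fin N) (Fin N) ℂ) (specialUnitaryLogChart (Fin N)).lie)) := by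
  intro Y'
  -- the configuration `U₁ = U[β(c) ↦ g₁]`, `g₁ = pre⁻¹ W₁ post⁻¹`, is loop-`α`-small at `c`
  have hW₁eq : pre U c * ((pre U c)⁻¹ * W₁ * (post U c)⁻¹) * post U c = W₁ := by group
  have hαU₁ : ∀ i : Idx P, dist1 (loopHol (update U (centralBond c) ((pre U c)⁻¹ * W₁ * (post U c)⁻¹)) c i) ≤ α := by
    rw [loopHol_update_centralBond_self hj, hW₁eq]; exact hW₁
  have hY' := mem_specialUnitaryLogChart_lie.1 Y'.2
  obtain ⟨Y, hY⟩ := N07CentralResponseOnto.centralResponse_onto_sharp hj (update U (centralBond c) ((pre U c)⁻¹ * W₁ * (post U c)⁻¹)) c hαU₁ hα24 hαδ hαL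
    ⟨(Y' : Matrix (Fin N) (Fin N) ℂ), T4AdjointCovarianceUnitary.mem_lieSU_iff.2 hY'⟩
  rw [update_self, avgFun_update_centralBond_self hj, hW₁eq] at hY
  -- the direction `Z = post⋆ · Y · post`
  have hqstar : star ((post U c : SU N) : Matrix (Fin N) (Fin N) ℂ) ∈ Matrix.specialUnitaryGroup (Fin N) ℂ := by rw [← coe_inv_SU]; exact ((post U c)⁻¹).2
  have hZmem := conj_mem_lie (N := N) hqstar (T4AdjointCovarianceUnitary.mem_lieSU_iff.1 Y.2)
  rw [star_star] at hZmem
  refine ⟨⟨star ((post U c : SU N) : Matrix (Fin N) (Fin N) ℂ) * (Y : Matrix (Fin N) (Fin N) ℂ) * ((post U c : SU N) : Matrix (Fin N) (Fin N) ℂ),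
    mem_specialUnitaryLogChart_lie.2 hZmem⟩, ?_⟩
  apply Subtype.ext
  rw [(coe_sliceDeriv_apply hj U c hαδ EE hEE Φ hΦ hW₁ _).2]
  have hconj : ((post U c : SU N) : Matrix (Fin N) (Fin N) ℂ) *
      (star ((post U c : SU N) : Matrix (Fin N) (Fin N) ℂ) * (Y : Matrix (Fin N) (Fin N) ℂ) * ((post U c : SU N) : Matrix (Fin N) (Fin N) ℂ)) *
        star ((post U c : SU N) : Matrix (Fin N) (Fin N) ℂ) = (Y : Matrix (Fin N) (Fin N) ℂ) := by
    have h1 : ((post U c : SU N) : Matrix (Fin N) (Fin N) ℂ) * star ((post U c : SU N) : Matrix (Fin N) (Fin N) ℂ) = 1 := coe_mul_star_coe_SU _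
    calc ((post U c : SU N) : Matrix (Fin N) (Fin N) ℂ) *
        (star ((post U c : SU N) : Matrix (Fin N) (Fin N) ℂ) * (Y : Matrix (Fin N) (Fin N) ℂ) * ((post U c : SU N) : Matrix (Fin N) (Fin N) ℂ)) *
          star ((post U c : SU N) : Matrix (Fin N) (Fin N) ℂ)
        = (((post U c : SU N) : Matrix (Fin N) (Fin N) ℂ) * star ((post U c : SU N) : Matrix (Fin N) (Fin N) ℂ)) * (Y : Matrix (Fin N) (Fin N) ℂ) *
          (((post U c : SU N) : Matrix (Fin N) (Fin N) ℂ) * star ((post U c : SU N) : Matrix (Fin N) (Fin N) ℂ)) := by noncomm_ring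
      _ = (Y : Matrix (Fin N) (Fin N) ℂ) := by rw [h1, one_mul, mul_one]
  show star ((fibreMap (expMeanLogSU (n := Fin N)) U c W₁ : SU N) : Matrix (Fin N) (Fin N) ℂ) *
      fderiv ℝ (fun W : PBond P j → Matrix (Fin N) (Fin N) ℂ => avgM W c) (coeField (update U (centralBond c) ((pre U c)⁻¹ * W₁ * (post U c)⁻¹)))
        (Pi.single (centralBond c) ((((pre U c)⁻¹ * W₁ * (post U c)⁻¹ : SU N) : Matrix (Fin N) (Fin N) ℂ) *
          (((post U c : SU N) : Matrix (Fin N) (Fin N) ℂ) *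
            (star ((post U c : SU N) : Matrix (Fin N) (Fin N) ℂ) * (Y : Matrix (Fin N) (Fin N) ℂ) * ((post U c : SU N) : Matrix (Fin N) (Fin N) ℂ)) *
              star ((post U c : SU N) : Matrix (Fin N) (Fin N) ℂ)))) = (Y' : Matrix (Fin N) (Fin N) ℂ)
  rw [hconj, hY, ← mul_assoc, star_coe_mul_coe_SU, one_mul]

/-- ★★★ **`det D_X Φ((V(U),↑W₁),0) ≠ 0` at every window point `W₁`** (onto endomorphism of the finite-dimensional `𝔰𝔲(N)`). [cite: Balaban1985Averaging, Prop. 3 (124) p.36; Balaban1987RG1, (2.10) p.267] -/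
theorem det_sliceDeriv_ne_zero (hj : j + 1 ≤ P.m + P.K) (U : GaugeField P j (SU N)) (c : PBond P (j + 1)) {α : ℝ}
    (hα24 : α ≤ 1 / 24) (hαδ : α < deltaSU (Fin N)) (hαL : 157 * α < ((P.L : ℝ) ^ (P.d - 1))⁻¹)
    (EE : (Idx P → Matrix (Fin N) (Fin N) ℂ) → Matrix (Fin N) (Fin N) ℂ → Matrix (Fin N) (Fin N) ℂ)
    (hEE : ∀ V A, EE V A = eml (fun i : Idx P => if IsCentral c i then (1 : Matrix (Fin N) (Fin N) ℂ) else V i * star A) * A)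
    (Φ : ((Idx P → Matrix (Fin N) (Fin N) ℂ) × Matrix (Fin N) (Fin N) ℂ) × (specialUnitaryLogChart (Fin N)).lie → (specialUnitaryLogChart (Fin N)).lie)
    (hΦ : ∀ p, Φ p = HaarExpChartLocal.proj (specialUnitaryLogChart (Fin N))
      (mlog (star (EE p.1.1 p.1.2) * EE p.1.1 (p.1.2 * exp ((p.2 : (specialUnitaryLogChart (Fin N)).lie) : Matrix (Fin N) (Fin N) ℂ)))))
    {W₁ : SU N} (hW₁ : ∀ i : Idx P, dist1 (fibreFamily U c W₁ i) ≤ α) :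
    ((fderiv ℝ Φ ((fun i => ((openHol U c i : SU N) : Matrix (Fin N) (Fin N) ℂ), (W₁ : Matrix (Fin N) (Fin N) ℂ)), 0)).comp
      (ContinuousLinearMap.inr ℝ ((Idx P → Matrix (Fin N) (Fin N) ℂ) × Matrix (Fin N) (Fin N) ℂ) (specialUnitaryLogChart (Fin N)).lie)).det ≠ 0 := by
  have hs := sliceDeriv_surjective hj U c hα24 hαδ hαL EE hEE Φ hΦ hW₁
  set D := (fderiv ℝ Φ ((fun i => ((openHol U c i : SU N) : Matrix (Fin N) (Fin N) ℂ), (W₁ : Matrix (Fin N) (Fin N) ℂ)), 0)).comp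
      (ContinuousLinearMap.inr ℝ ((Idx P → Matrix (Fin N) (Fin N) ℂ) × Matrix (Fin N) (Fin N) ℂ) (specialUnitaryLogChart (Fin N)).lie) with hD
  have hrange : LinearMap.range (D : (specialUnitaryLogChart (Fin N)).lie →ₗ[ℝ] (specialUnitaryLogChart (Fin N)).lie) = ⊤ :=
    LinearMap.range_eq_top.2 hs
  have hu : IsUnit (D : (specialUnitaryLogChart (Fin N)).lie →ₗ[ℝ] (specialUnitaryLogChart (Fin N)).lie) := (LinearMap.isUnit_iff_range_eq_top _).2 hrange
  exact (LinearMap.isUnit_det _ hu).ne_zero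

end Base

end Summit.QuantumFields.YangMills.BalabanUVNodes.N09CentralWindowNondegenerate
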